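import Summits.AnomalousDissipation.AnomalousDissipation.Theorems.SawtoothPulseCascadeK1LocalisedCascadeKHLineKernel
import Summits.AnomalousDissipation.AnomalousDissipation.Theorems.SawtoothPulseCascadeK1LocalisedCascadeKHPropagatorODE

/-!
# K2 typed slot map (planner p4, `K2TypedSlotMap.lean` 5cbecd5f08b7): the four identity targets, with the kernel SIGN CORRECTED, PROVED

prover ad-k1loc-p2 g9 (K2 lane), crux workfile on the dir of stmt-AnomalousDissipation-19491.
FINDING. In `K2TypedSlotMap.lean` the closed form of the periodised line kernel is typed as
`(-(e^{−κr} : ℂ) / (1 − z̄ e^{−κ}) + (e^{κ(r−1)} : ℂ) * z / (1 − z e^{−κ})) / (2κ)`; Lean parses `-A / B + C` as `(-A)/B + C`, so only the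
`n ≤ 0` branch of the lattice sum `Σ_n e^{2πiβn} g(r − n)`, `g(y) = −e^{−κ|y|}/(2κ)`, carries its minus sign. The intended kernel is
`−(e^{−κr}/(1 − z̄q) + z e^{κ(r−1)}/(1 − zq))/(2κ)` (checked against the direct lattice sum to 1e−9, and against `sawSigma0`/`sawS` to 1e−16);
as typed, `KernelAtZero`/`KernelAtHalf`/`BlockSq` are false (`a = 0.3, β = 0.1`: `|2πG(0) − Σ₀| = 0.574`).
THIS FILE repeats p4's definitions `lineKernel` (with the one-character fix: the leading `-` now applies to the whole bracket), `blockX`, `khLam`,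
`propC`, `propSn`, `propagator` and the four target Props VERBATIM otherwise, and PROVES `KernelAtZero`, `KernelAtHalf`, `BlockSq`, `PropagatorODE`
from the tree theorems `twoPi_lineKernel_zero`, `twoPi_conj_lineKernel_half`, `blockX_sq_of` (p684501) and `propagator_one_of`,
`propagator_hasDerivAt_of` (p684727) — all `--supports 19491`. (`K2TypedSlotMap.lean` itself is not an importable module on the farm.)
Nothing here is S2-cert or K2; it certifies the typed block/propagator layer of the slot map against the tree.
-/

set_option linter.dupNamespace false

namespace Summit.AnomalousDissipation.AnomalousDissipation.Cruxes.K1LocalisedCascade.K2SlotMapFixed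

open Complex MeasureTheory intervalIntegral
open Literature.Analysis.FluidPDE.SawtoothCascade
open Summit.AnomalousDissipation.AnomalousDissipation.Theorems.SawtoothPulseCascade.K2PhaseBudget

noncomputable section

/-! ## 1. Definitions (p4's, kernel sign corrected) -/

/-- The periodised Biot–Savart LINE KERNEL `G_{a,β}(y) = Σ_{n∈ℤ} e^{2πiβn} g(y - n)`, `g(y) = -e^{-κ|y|}/(2κ)`, `κ = 2π|a|`, in closed
form on `y = ⌊y⌋ + r`: `e^{2πiβ⌊y⌋} · ( −( e^{-κr}/(1 - e^{-2πiβ}e^{-κ}) + e^{κ(r-1)} e^{2πiβ}/(1 - e^{2πiβ}e^{-κ}) ) / (2κ) )`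
— p4's `lineKernel` with the minus sign applied to BOTH lattice branches. -/
def lineKernel (a β y : ℝ) : ℂ :=
  let κ : ℝ := 2 * Real.pi * |a|
  let r : ℝ := y - (⌊y⌋ : ℝ)
  let z : ℂ := Complex.exp (2 * Real.pi * β * Complex.I)
  Complex.exp (2 * Real.pi * β * (⌊y⌋ : ℝ) * Complex.I) *
    ((-(((Real.exp (-(κ * r)) : ℂ) / (1 - (starRingEnd ℂ z) * (Real.exp (-κ) : ℂ)))
          + (Real.exp (κ * (r - 1)) : ℂ) * z / (1 - z * (Real.exp (-κ) : ℂ)))) / (2 * κ : ℂ))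

/-- p4's `blockX` (verbatim): `X = 2πia · [[-1/4 - 2G(0), -2G(1/2)], [2 conj G(1/2), 1/4 + 2G(0)]]`. -/
def blockX (a β : ℝ) : Matrix (Fin 2) (Fin 2) ℂ :=
  ((2 * Real.pi * a : ℝ) * Complex.I : ℂ) •
    !![-(1 / 4 : ℂ) - 2 * lineKernel a β 0, -2 * lineKernel a β (1 / 2);
       2 * starRingEnd ℂ (lineKernel a β (1 / 2)), (1 / 4 : ℂ) + 2 * lineKernel a β 0]

/-- p4's `khLam` (verbatim): `λ(a, β) = -a²·c²(a, β)`. -/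
def khLam (a β : ℝ) : ℝ := -(a ^ 2 * sawC2 a β)

/-- p4's `propC` (verbatim). -/
def propC (a β t : ℝ) : ℝ :=
  if 0 < khLam a β then Real.cosh (Real.sqrt (khLam a β) * t)
  else if khLam a β < 0 then Real.cos (Real.sqrt (-(khLam a β)) * t) else 1

/-- p4's `propSn` (verbatim). -/
def propSn (a β t : ℝ) : ℝ :=
  if 0 < khLam a β then Real.sinh (Real.sqrt (khLam a β) * t) / Real.sqrt (khLam a β)
  else if khLam a β < 0 then Real.sin (Real.sqrt (-(khLam a β)) * t) / Real.sqrt (-(khLam a β)) else t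

/-- p4's `propagator` (verbatim): `P(t) = C(t)·1 + Sn(t)·X`. -/
def propagator (a β t : ℝ) : Matrix (Fin 2) (Fin 2) ℂ :=
  ((propC a β t : ℝ) : ℂ) • (1 : Matrix (Fin 2) (Fin 2) ℂ) + ((propSn a β t : ℝ) : ℂ) • blockX a β

/-! ## 2. The four target Props (verbatim) -/

/-- Kernel ↔ tree, diagonal entry: `2π G_{a,β}(0) = Σ₀(a, β)` for `a > 0`. -/
def KernelAtZero : Prop :=
  ∀ a β : ℝ, 0 < a → (2 * Real.pi : ℂ) * lineKernel a β 0 = ((sawSigma0 a β : ℝ) : ℂ)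

/-- Kernel ↔ tree, off-diagonal entry: `2π conj G_{a,β}(1/2) = S_β(a)` for `a > 0`. -/
def KernelAtHalf : Prop :=
  ∀ a β : ℝ, 0 < a → (2 * Real.pi : ℂ) * starRingEnd ℂ (lineKernel a β (1 / 2)) = sawS a β

/-- `X² = λ • 1` with `λ = -a² c²(a,β)`. -/
def BlockSq : Prop :=
  ∀ a β : ℝ, 0 < a → blockX a β * blockX a β = ((khLam a β : ℝ) : ℂ) • (1 : Matrix (Fin 2) (Fin 2) ℂ)

/-- The propagator solves the block ODE: `P(0) = 1`, `d/dt P(t) = X · P(t)`. -/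
def PropagatorODE : Prop :=
  ∀ a β : ℝ, 0 < a → propagator a β 0 = 1 ∧
    ∀ t : ℝ, HasDerivAt (fun s => propagator a β s) (blockX a β * propagator a β t) t

/-! ## 3. Proofs -/

/-- `KernelAtZero` holds (tree: `twoPi_lineKernel_zero`, p684501). -/
theorem kernelAtZero : KernelAtZero := by
  intro a β ha
  have h := twoPi_lineKernel_zero ha β
  have hz : Complex.exp (2 * Real.pi * β * Complex.I) = Complex.exp (((2 * Real.pi * β : ℝ) : ℂ) * Complex.I) := by push_cast; ring_nf
  simp only [lineKernel, Int.floor_zero, Int.cast_zero, Complex.ofReal_zero, sub_zero, mul_zero, zero_mul, neg_zero, Real.exp_zero,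
    Complex.ofReal_one, Complex.exp_zero, one_mul, zero_sub, mul_neg, mul_one, abs_of_pos ha, hz]
  convert h using 3
  push_cast
  ring

/-- `KernelAtHalf` holds (tree: `twoPi_conj_lineKernel_half`, p684501). -/
theorem kernelAtHalf : KernelAtHalf := by
  intro a β ha
  have h := twoPi_conj_lineKernel_half ha β
  have hz : Complex.exp (2 * Real.pi * β * Complex.I) = Complex.exp (((2 * Real.pi * β : ℝ) : ℂ) * Complex.I) := by push_cast; ring_nf
  have hfl : ⌊(1 / 2 : ℝ)⌋ = 0 := by norm_num [Int.floor_eq_zero_iff]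
  have he1 : Real.exp (-(2 * Real.pi * a * (1 / 2))) = Real.exp (-(a * Real.pi)) := by congr 1; ring
  have he2 : Real.exp (2 * Real.pi * a * (1 / 2 - 1)) = Real.exp (-(a * Real.pi)) := by congr 1; ring
  simp only [lineKernel, hfl, Int.cast_zero, Complex.ofReal_zero, sub_zero, mul_zero, zero_mul, Complex.exp_zero, one_mul,
    abs_of_pos ha, hz, he1, he2]
  convert h using 3
  push_cast
  ring

/-- `BlockSq` holds (tree: `blockX_sq_of`, p684501). -/
theorem blockSq : BlockSq := fun a β ha => blockX_sq_of (kernelAtZero a β ha) (kernelAtHalf a β ha)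

/-- `PropagatorODE` holds (tree: `propagator_one_of`, `propagator_hasDerivAt_of`, p684727). -/
theorem propagatorODE : PropagatorODE := fun a β ha =>
  ⟨propagator_one_of (blockX a β) (khLam a β), fun t => propagator_hasDerivAt_of (blockSq a β ha) t⟩

end

end Summit.AnomalousDissipation.AnomalousDissipation.Cruxes.K1LocalisedCascade.K2SlotMapFixed
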